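import Mathlib.MeasureTheory.Function.Jacobian
import Mathlib.Analysis.Calculus.InverseFunctionTheorem.ApproximatesLinearOn
import Mathlib.Analysis.Calculus.MeanValue
import Mathlib.Analysis.Calculus.ContDiff.RCLike
import HarnessLib

/-!
# `FluctuationComparisonRegPrIntLQuantLemmaAEuclid` — QUANTITATIVE LEMMA A (euclidean core): a `C¹` map with invertible
# derivative on a compact set pulls an additive Haar measure back to AT MOST A CONSTANT MULTIPLE of itself
# (crux `UnitScaleTilt.FluctuationComparisonRegPrIntL`, stmt-QuantumFields-20520; helper `--supports`, count-neutral)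

Cell `ym3-torus` (YM ladder rung R3 = continuum SU(2) Yang–Mills on T³ — a RUNG, NOT the Clay problem: not d = 4, not
infinite volume, not a mass gap); seat `ym-line-cst-p1` (gen 35), named hand of ★★OWNER WORD 96 (2)(a) for the depth-one FLOOR
rows of the TAILSUP₁∘ door suite (✓`…SupTailCoverUnionTwoRegime` v1.2, p762504).  THEOREMS ONLY (0 `def`, 0 `sorry`, default
heartbeats); pure finite-dimensional measure theory over Mathlib — nothing of Bałaban's is asserted.

WHY.  The depth-one floor `ofReal q·Gibbs_{J+1}(D⁻¹B) ≤ Gibbs_{J+1}(D⁻¹B ∩ histGood)` for ALL measurable `B` in the open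
interior window reduces (seat px21 g13, 2026-08-30T05:23Z; this seat 05:28Z, independently from the symmetry side) to the
WREG floor of the hist-restricted canonical density (in the tree) AND ONE located letter: an `L^∞` bound for the image law of
product Haar measure under ONE (0.4) block averaging `avgFun ℰp` on (a neighbourhood of) the window.  The tree has ABSOLUTE
CONTINUITY of that image law (lit ✓`BlockAveragingEMLHaarACSUN.haarAC_avgFun_expMeanLogSU_SUN`) through the soft LEMMA A of lit
✓`T4RadialProjectionAC` §1 ∕ ✓`T4HaarUnitaryLocalDiffeo` (a map with injective tangent derivative pulls null sets back to
null sets).  This file is the QUANTITATIVE euclidean core of the same road: with a CONTINUOUS derivative, invertible on a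
COMPACT set `K`, the pull-back of every measurable set has measure at most `C·μ` — the constant depends on the map through a
finite cover of `K` by injectivity balls and the Jacobian floors on them (no explicit formula is claimed).

CONTENTS.
* §1 ★ `measure_inter_preimage_le_of_injOn_of_det_ge` — ONE PIECE: `f` injective on a measurable `s` with derivative `f′`
  within `s` and `m ≤ |det f′|` on `s` (`m > 0`) ⟹ `μ (s ∩ f⁻¹ T) ≤ m⁻¹·μ T` (Mathlib's change of variables
  `lintegral_image_eq_lintegral_abs_det_fderiv_mul` with `g ≡ 1`, and `f '' (s ∩ f⁻¹T) ⊆ T`).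
* §2 ★ `exists_injOn_nhds_of_hasFDerivAt` — LOCAL INJECTIVITY WITH A JACOBIAN FLOOR: `f` with `HasFDerivAt f (f′ y) y` on an
  open `O`, `f′` continuous on `O`, `det f′ x ≠ 0` ⟹ a measurable neighbourhood `s ⊆ O` of `x` on which `f` is injective and
  `|det f′ x|∕2 ≤ |det f′|` (mean-value inequality ⟹ `ApproximatesLinearOn f (f′ x) (ball x ε) c` with `c < ‖(f′ x)⁻¹‖⁻¹`,
  then `ApproximatesLinearOn.injOn`; continuity of `det`).
* §3 ★★ `exists_measure_inter_preimage_le_of_fderiv_continuousOn` and ★★ `exists_restrict_map_le_smul` — QUANTITATIVE LEMMA A: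
  `K` compact, `K ⊆ O` open, `f` measurable with continuous derivative on `O`, invertible on `K` ⟹
  `∃ C < ∞, ∀ T measurable, μ (K ∩ f⁻¹ T) ≤ C·μ T`, i.e. `(μ.restrict K).map f ≤ C • μ` (finite subcover of §2 pieces, §1 on each).
* §4 ★★ `exists_restrict_map_le_smul_of_contDiffOn` ∕ `exists_measure_inter_preimage_le_of_contDiffOn` — the `C¹` INTERFACE
  (`ContDiffOn ℝ 1 f O` and, on `K`, `∃ D : E ≃L[ℝ] E, HasFDerivAt f D x`): the form in which cone extensions of maps of the unit
  sphere of `ℍ` (the `SU(2)` road of lit ✓`T4HaarSU2LocalDiffeo.exists_equiv_hasStrictFDerivAt_coneExt`) dock.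
* §5 ★★ `exists_injOn_nhds_param`, `exists_measure_inter_preimage_le_param` — the PARAMETRIC form: a compact `𝒦 ⊆ F × E` of
  (parameter, point) pairs inside an open `𝒰` on which `(p, y) ↦ f′ p y` is jointly continuous ⟹ ONE constant for every parameter
  (`μ ({x | (p, x) ∈ 𝒦} ∩ (f p)⁻¹ T) ≤ C·μ T`) — the form the environment-uniform one-variable bound of a block averaging needs
  (the environment ranges over a compact group).
* §6 ★★ `exists_measure_inter_preimage_le_param_of_contDiffOn` — the parametric `C¹` interface (`φ : F × E → E`,
  `ContDiffOn ℝ 1 φ 𝒰`, invertible partial derivative on `𝒦`).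

NEXT (not here): the transfer to `U(N)`∕`SU(N)` through the tree's Cayley chart with its two-sided Haar∕Lebesgue comparison
(lit `UnitaryCayleyChart`, `T4HaarUnitaryLocalDiffeo` §2) with a FINITE translate cover, and the map-specific input at the
guarded exp-mean-log one-variable fibre map (lit ✓`T4EMLTangentInjective.hasStrictFDerivAt_Kmat` ∕ `emlD_tangent_injective` on
the closed guard, plus joint continuity of `emlD`); then the assembly over central bonds (lit ✓`T4TriangularPushforward`).
HONEST: folklore measure theory; no row, stub, crux or summit statement is proved by this file; FLOOR₁∘ ∕ TAILSUP₁∘ ∕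
stmt-QuantumFields-20520 NOT proved; rung R3 = SU(2) YM₃ on T³ — NOT d = 4, NOT infinite volume, NOT a mass gap, NOT Clay.
-/

set_option autoImplicit false

noncomputable section

open MeasureTheory Set Metric Filter Topology Function
open scoped ENNReal NNReal BigOperators

namespace Summit.QuantumFields.YangMills.Theorems.FluctuationComparisonRegPrIntLQuantLemmaAEuclid

variable {E : Type*} [NormedAddCommGroup E] [NormedSpace ℝ E] [FiniteDimensional ℝ E]
  [MeasurableSpace E] [BorelSpace E]

/-! ## §1 One injectivity piece: change of variables with a Jacobian floor -/

/-- ★ **ONE PIECE OF QUANTITATIVE LEMMA A.**  If `f` is injective on a measurable set `s`, has the derivative `f′ y` within `s` at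
every `y ∈ s`, and `0 < m ≤ |det (f′ y)|` on `s`, then for every measurable `T` the part of `s` that `f` maps into `T` has
`μ`-measure at most `m⁻¹·μ T` (`μ` any additive Haar measure): by Mathlib's change of variables
`μ (f '' s′) = ∫⁻_{s′} |det f′| ≥ m·μ s′` for `s′ = s ∩ f⁻¹ T`, and `f '' s′ ⊆ T`. [folklore] -/
theorem measure_inter_preimage_le_of_injOn_of_det_ge (μ : Measure E) [μ.IsAddHaarMeasure] {s : Set E}
    (hs : MeasurableSet s) {f : E → E} (hfm : Measurable f) {f' : E → E →L[ℝ] E}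
    (hf' : ∀ y ∈ s, HasFDerivWithinAt f (f' y) s y) (hinj : InjOn f s) {m : ℝ} (hm : 0 < m)
    (hdet : ∀ y ∈ s, m ≤ |(f' y).det|) {T : Set E} (hT : MeasurableSet T) :
    μ (s ∩ f ⁻¹' T) ≤ ENNReal.ofReal m⁻¹ * μ T := by
  set s' : Set E := s ∩ f ⁻¹' T with hs'def
  have hs' : MeasurableSet s' := hs.inter (hfm hT)
  have hf's : ∀ y ∈ s', HasFDerivWithinAt f (f' y) s' y := fun y hy => (hf' y hy.1).mono inter_subset_left
  have hinj' : InjOn f s' := hinj.mono inter_subset_left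
  have himg : f '' s' ⊆ T := by
    rintro _ ⟨y, hy, rfl⟩
    exact hy.2
  have key := lintegral_image_eq_lintegral_abs_det_fderiv_mul μ hs' hf's hinj' (fun _ => 1)
  have hlow : ENNReal.ofReal m * μ s' ≤ ∫⁻ y in s', ENNReal.ofReal |(f' y).det| * 1 ∂μ := by
    calc ENNReal.ofReal m * μ s' = ∫⁻ _ in s', ENNReal.ofReal m ∂μ := by
          rw [setLIntegral_const, mul_comm]
      _ ≤ ∫⁻ y in s', ENNReal.ofReal |(f' y).det| * 1 ∂μ := by
          refine setLIntegral_mono' hs' fun y hy => ?_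
          rw [mul_one]
          exact ENNReal.ofReal_le_ofReal (hdet y hy.1)
  have hup : ∫⁻ _ in f '' s', (1 : ℝ≥0∞) ∂μ ≤ μ T := by
    rw [setLIntegral_const, one_mul]
    exact measure_mono himg
  have hmain : ENNReal.ofReal m * μ s' ≤ μ T := hlow.trans (key ▸ hup)
  have hm0 : ENNReal.ofReal m ≠ 0 := (ENNReal.ofReal_pos.mpr hm).ne'
  calc μ s' = (ENNReal.ofReal m)⁻¹ * (ENNReal.ofReal m * μ s') := by
        rw [← mul_assoc, ENNReal.inv_mul_cancel hm0 ENNReal.ofReal_ne_top, one_mul]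
    _ ≤ (ENNReal.ofReal m)⁻¹ * μ T := by gcongr
    _ = ENNReal.ofReal m⁻¹ * μ T := by rw [ENNReal.ofReal_inv_of_pos hm]

/-! ## §2 Local injectivity with a Jacobian floor around a point of invertibility -/

/-- ★ **LOCAL INJECTIVITY PIECE.**  If `f` has the derivative `f′ y` at every point `y` of an open set `O`, `f′` is continuous
on `O`, `x ∈ O` and `det (f′ x) ≠ 0`, then some measurable neighbourhood `s ⊆ O` of `x` (an open ball) has `f` injective on
`s` and `|det (f′ x)|∕2 ≤ |det (f′ y)|` for `y ∈ s`.  Injectivity: on a ball where `‖f′ y − f′ x‖ ≤ c` the mean-value inequality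
gives `ApproximatesLinearOn f (f′ x) (ball x ε) c`, and `c < ‖(f′ x)⁻¹‖⁻¹` makes `f` injective there
(`ApproximatesLinearOn.injOn`). [folklore] -/
theorem exists_injOn_nhds_of_hasFDerivAt {O : Set E} (hO : IsOpen O) {f : E → E} {f' : E → E →L[ℝ] E}
    (hf : ∀ y ∈ O, HasFDerivAt f (f' y) y) (hc : ContinuousOn f' O) {x : E} (hx : x ∈ O) (hdet : (f' x).det ≠ 0) :
    ∃ s : Set E, s ∈ 𝓝 x ∧ MeasurableSet s ∧ s ⊆ O ∧ InjOn f s ∧ ∀ y ∈ s, |(f' x).det| / 2 ≤ |(f' y).det| := by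
  -- the derivative at `x` as a continuous linear equivalence
  set A : E ≃L[ℝ] E := (f' x).toContinuousLinearEquivOfDetNeZero hdet with hAdef
  have hAcoe : (A : E →L[ℝ] E) = f' x := (f' x).coe_toContinuousLinearEquivOfDetNeZero hdet
  -- the approximation constant: half of `‖A⁻¹‖⁻¹` (as an `ℝ≥0`), positive when `E` is nontrivial
  set c : ℝ≥0 := ‖(A.symm : E →L[ℝ] E)‖₊⁻¹ / 2 with hcdef
  have hδ : 0 < |(f' x).det| / 2 := by positivity
  -- an open set of linear maps around `f' x`: close to `f' x` in norm (when `c > 0`) and with determinant above the floor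
  set W : Set (E →L[ℝ] E) :=
    {L | Subsingleton E ∨ ‖L - f' x‖ < c} ∩ {L | |(f' x).det| / 2 < |L.det|} with hWdef
  have hW₁ : IsOpen {L : E →L[ℝ] E | Subsingleton E ∨ ‖L - f' x‖ < c} := by
    rw [setOf_or]
    exact isOpen_const.union (isOpen_lt (continuous_norm.comp (continuous_id.sub continuous_const)) continuous_const)
  have hW₂ : IsOpen {L : E →L[ℝ] E | |(f' x).det| / 2 < |L.det|} :=
    isOpen_lt continuous_const (continuous_abs.comp ContinuousLinearMap.continuous_det)
  have hWopen : IsOpen W := hW₁.inter hW₂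
  have hxW : f' x ∈ W := by
    refine ⟨?_, ?_⟩
    · rcases subsingleton_or_nontrivial E with hE | hE
      · exact Or.inl hE
      · right
        rw [sub_self, norm_zero]
        have hpos : 0 < ‖(A.symm : E →L[ℝ] E)‖₊ := A.symm.norm_pos
        have : (0 : ℝ≥0) < c := by
          rw [hcdef]
          exact div_pos (inv_pos.mpr hpos) two_pos
        exact_mod_cast this
    · exact half_lt_self (abs_pos.mpr hdet)
  -- the open set `O ∩ f′⁻¹ W` contains a ball around `x`
  have hVopen : IsOpen (O ∩ f' ⁻¹' W) := hc.isOpen_inter_preimage hO hWopen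
  obtain ⟨ε, hε, hball⟩ := Metric.isOpen_iff.mp hVopen x ⟨hx, hxW⟩
  refine ⟨ball x ε, ball_mem_nhds x hε, isOpen_ball.measurableSet, fun y hy => (hball hy).1, ?_, fun y hy =>
    ((hball hy).2.2).le⟩
  -- injectivity on the ball
  rcases subsingleton_or_nontrivial E with hE | hE
  · exact (injective_of_subsingleton f).injOn
  · have happrox : ApproximatesLinearOn f (A : E →L[ℝ] E) (ball x ε) c := by
      intro y hy z hz
      exact Convex.norm_image_sub_le_of_norm_hasFDerivWithin_le'
        (f := f) (f' := f') (φ := (A : E →L[ℝ] E)) (C := (c : ℝ))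
        (fun w hw => (hf w (hball hw).1).hasFDerivWithinAt)
        (fun w hw => by
          rw [hAcoe]
          exact (((hball hw).2.1).resolve_left (not_subsingleton E)).le)
        (convex_ball x ε) hz hy
    refine happrox.injOn (Or.inr ?_)
    have hpos : 0 < ‖(A.symm : E →L[ℝ] E)‖₊ := A.symm.norm_pos
    rw [hcdef]
    exact NNReal.half_lt_self (inv_pos.mpr hpos).ne'

/-! ## §3 Quantitative Lemma A: compact set, continuous invertible derivative -/

/-- ★★ **QUANTITATIVE LEMMA A (euclidean, set form).**  Let `μ` be an additive Haar measure on a finite-dimensional real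
normed space `E`, `O ⊆ E` open, `K ⊆ O` compact, `f : E → E` measurable with `HasFDerivAt f (f′ y) y` for `y ∈ O`, `f′`
continuous on `O` and `det (f′ x) ≠ 0` for every `x ∈ K`.  Then there is a finite constant `C` with
`μ (K ∩ f⁻¹ T) ≤ C·μ T` for every measurable `T` (finite subcover of `K` by the injectivity pieces of §2, §1 on each piece;
`C = Σ_i 2∕|det f′(x_i)|`). [folklore] -/
theorem exists_measure_inter_preimage_le_of_fderiv_continuousOn (μ : Measure E) [μ.IsAddHaarMeasure] {O K : Set E}
    (hO : IsOpen O) (hK : IsCompact K) (hKO : K ⊆ O) {f : E → E} (hfm : Measurable f) {f' : E → E →L[ℝ] E}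
    (hf : ∀ y ∈ O, HasFDerivAt f (f' y) y) (hc : ContinuousOn f' O) (hdet : ∀ x ∈ K, (f' x).det ≠ 0) :
    ∃ C : ℝ≥0∞, C ≠ ∞ ∧ ∀ T : Set E, MeasurableSet T → μ (K ∩ f ⁻¹' T) ≤ C * μ T := by
  -- local pieces around every point of `K`
  have hloc : ∀ x ∈ K, ∃ s : Set E, s ∈ 𝓝 x ∧ MeasurableSet s ∧ s ⊆ O ∧ InjOn f s ∧
      ∀ y ∈ s, |(f' x).det| / 2 ≤ |(f' y).det| :=
    fun x hx => exists_injOn_nhds_of_hasFDerivAt hO hf hc (hKO hx) (hdet x hx)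
  choose! U hUnhds hUmeas hUO hUinj hUdet using hloc
  obtain ⟨t, htK, hcover⟩ := hK.elim_nhds_subcover U fun x hx => hUnhds x hx
  refine ⟨∑ x ∈ t, ENNReal.ofReal (|(f' x).det| / 2)⁻¹, ?_, fun T hT => ?_⟩
  · exact ENNReal.sum_ne_top.mpr fun x _ => ENNReal.ofReal_ne_top
  · -- the piece estimate of §1 on each `U x`, `x ∈ t`
    have hpiece : ∀ x ∈ t, μ (U x ∩ f ⁻¹' T) ≤ ENNReal.ofReal (|(f' x).det| / 2)⁻¹ * μ T := by
      intro x hxt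
      have hxK : x ∈ K := htK x hxt
      have hδ : 0 < |(f' x).det| / 2 := by have := hdet x hxK; positivity
      exact measure_inter_preimage_le_of_injOn_of_det_ge μ (hUmeas x hxK) hfm
        (fun y hy => (hf y (hUO x hxK hy)).hasFDerivWithinAt) (hUinj x hxK) hδ (hUdet x hxK) hT
    calc μ (K ∩ f ⁻¹' T) ≤ μ ((⋃ x ∈ t, U x) ∩ f ⁻¹' T) :=
          measure_mono (inter_subset_inter_left _ hcover)
      _ = μ (⋃ x ∈ t, (U x ∩ f ⁻¹' T)) := by rw [iUnion₂_inter]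
      _ ≤ ∑ x ∈ t, μ (U x ∩ f ⁻¹' T) := measure_biUnion_finset_le t _
      _ ≤ ∑ x ∈ t, ENNReal.ofReal (|(f' x).det| / 2)⁻¹ * μ T := Finset.sum_le_sum hpiece
      _ = (∑ x ∈ t, ENNReal.ofReal (|(f' x).det| / 2)⁻¹) * μ T := by rw [Finset.sum_mul]

/-- ★★ **QUANTITATIVE LEMMA A (euclidean, measure form).**  Under the hypotheses of
`exists_measure_inter_preimage_le_of_fderiv_continuousOn`, the image of `μ` restricted to `K` under `f` is dominated by a
constant multiple of `μ`: `(μ.restrict K).map f ≤ C • μ` with `C : ℝ≥0` — the `L^∞` upgrade of the absolute continuity supplied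
by the tree's soft Lemma A (lit `T4RadialProjectionAC` §1). [folklore] -/
theorem exists_restrict_map_le_smul (μ : Measure E) [μ.IsAddHaarMeasure] {O K : Set E} (hO : IsOpen O)
    (hK : IsCompact K) (hKO : K ⊆ O) {f : E → E} (hfm : Measurable f) {f' : E → E →L[ℝ] E}
    (hf : ∀ y ∈ O, HasFDerivAt f (f' y) y) (hc : ContinuousOn f' O) (hdet : ∀ x ∈ K, (f' x).det ≠ 0) :
    ∃ C : ℝ≥0, (μ.restrict K).map f ≤ (C : ℝ≥0∞) • μ := by
  obtain ⟨C, hCtop, hC⟩ := exists_measure_inter_preimage_le_of_fderiv_continuousOn μ hO hK hKO hfm hf hc hdet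
  refine ⟨C.toNNReal, Measure.le_iff.mpr fun T hT => ?_⟩
  rw [Measure.map_apply hfm hT, Measure.restrict_apply (hfm hT), Measure.smul_apply, smul_eq_mul,
    ENNReal.coe_toNNReal hCtop, inter_comm]
  exact hC T hT

/-! ## §4 The `C¹` interface: `ContDiffOn ℝ 1` and invertible derivatives on the compact set -/

omit [FiniteDimensional ℝ E] [MeasurableSpace E] [BorelSpace E] in
/-- A continuous linear equivalence has non-zero determinant (as a continuous linear map). [folklore] -/
theorem det_ne_zero_of_equiv (D : E ≃L[ℝ] E) : (D : E →L[ℝ] E).det ≠ 0 := by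
  have h : IsUnit (LinearMap.det ((D : E →L[ℝ] E) : E →ₗ[ℝ] E)) :=
    LinearEquiv.isUnit_det' (D.toLinearEquiv)
  exact h.ne_zero

/-- ★★ **QUANTITATIVE LEMMA A, `C¹` INTERFACE.**  `K` compact inside an open `O`, `f` measurable and `ContDiffOn ℝ 1 f O`, and at
every `x ∈ K` the derivative of `f` is a continuous linear EQUIVALENCE (`∃ D : E ≃L[ℝ] E, HasFDerivAt f D x`) ⟹
`∃ C : ℝ≥0, (μ.restrict K).map f ≤ C • μ`.  (Take `f′ := fderiv ℝ f`, continuous on the open `O` by `ContDiffOn`, and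
`det (fderiv ℝ f x) = det D ≠ 0` by uniqueness of the derivative; then `exists_restrict_map_le_smul`.) [folklore] -/
theorem exists_restrict_map_le_smul_of_contDiffOn (μ : Measure E) [μ.IsAddHaarMeasure] {O K : Set E} (hO : IsOpen O)
    (hK : IsCompact K) (hKO : K ⊆ O) {f : E → E} (hfm : Measurable f) (hC1 : ContDiffOn ℝ 1 f O)
    (hinv : ∀ x ∈ K, ∃ D : E ≃L[ℝ] E, HasFDerivAt f (D : E →L[ℝ] E) x) :
    ∃ C : ℝ≥0, (μ.restrict K).map f ≤ (C : ℝ≥0∞) • μ := by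
  have hdiff : ∀ y ∈ O, HasFDerivAt f (fderiv ℝ f y) y := fun y hy =>
    ((hC1.differentiableOn one_ne_zero y hy).differentiableAt (hO.mem_nhds hy)).hasFDerivAt
  have hcont : ContinuousOn (fderiv ℝ f) O := hC1.continuousOn_fderiv_of_isOpen hO le_rfl
  have hdet : ∀ x ∈ K, (fderiv ℝ f x).det ≠ 0 := by
    intro x hx
    obtain ⟨D, hD⟩ := hinv x hx
    rw [hD.fderiv]
    exact det_ne_zero_of_equiv D
  exact exists_restrict_map_le_smul μ hO hK hKO hfm hdiff hcont hdet

/-- The set form of the `C¹` interface: `∃ C ≠ ∞, ∀ T measurable, μ (K ∩ f⁻¹ T) ≤ C·μ T`. [folklore] -/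
theorem exists_measure_inter_preimage_le_of_contDiffOn (μ : Measure E) [μ.IsAddHaarMeasure] {O K : Set E} (hO : IsOpen O)
    (hK : IsCompact K) (hKO : K ⊆ O) {f : E → E} (hfm : Measurable f) (hC1 : ContDiffOn ℝ 1 f O)
    (hinv : ∀ x ∈ K, ∃ D : E ≃L[ℝ] E, HasFDerivAt f (D : E →L[ℝ] E) x) :
    ∃ C : ℝ≥0∞, C ≠ ∞ ∧ ∀ T : Set E, MeasurableSet T → μ (K ∩ f ⁻¹' T) ≤ C * μ T := by
  obtain ⟨C, hC⟩ := exists_restrict_map_le_smul_of_contDiffOn μ hO hK hKO hfm hC1 hinv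
  refine ⟨C, ENNReal.coe_ne_top, fun T hT => ?_⟩
  have h := hC T
  rw [Measure.map_apply hfm hT, Measure.restrict_apply (hfm hT), Measure.smul_apply, smul_eq_mul, inter_comm] at h
  exact h

/-! ## §5 The PARAMETRIC form: a compact family of maps, one constant -/

section Param

variable {F : Type*} [TopologicalSpace F]

/-- ★ **PARAMETRIC LOCAL INJECTIVITY PIECE.**  `f : F → E → E` with `HasFDerivAt (f p) (f′ p y) y` at every `(p, y)` of an
open `𝒰 ⊆ F × E`, `(p, y) ↦ f′ p y` continuous on `𝒰`, `(p, x) ∈ 𝒰`, `det (f′ p x) ≠ 0` ⟹ a neighbourhood `N` of `p` and a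
measurable neighbourhood `s` of `x` with `N ×ˢ s ⊆ 𝒰` such that for EVERY `p′ ∈ N`: `f p′` is injective on `s` and
`|det (f′ p x)|∕2 ≤ |det (f′ p′ y)|` on `s` (one approximating linear map `f′ p x` serves the whole neighbourhood). [folklore] -/
theorem exists_injOn_nhds_param {𝒰 : Set (F × E)} (h𝒰 : IsOpen 𝒰) {f : F → E → E} {f' : F → E → E →L[ℝ] E}
    (hf : ∀ q ∈ 𝒰, HasFDerivAt (f q.1) (f' q.1 q.2) q.2) (hc : ContinuousOn (fun q : F × E => f' q.1 q.2) 𝒰)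
    {p : F} {x : E} (hpx : (p, x) ∈ 𝒰) (hdet : (f' p x).det ≠ 0) :
    ∃ N : Set F, N ∈ 𝓝 p ∧ ∃ s : Set E, s ∈ 𝓝 x ∧ MeasurableSet s ∧ N ×ˢ s ⊆ 𝒰 ∧
      ∀ p' ∈ N, InjOn (f p') s ∧ ∀ y ∈ s, |(f' p x).det| / 2 ≤ |(f' p' y).det| := by
  set A : E ≃L[ℝ] E := (f' p x).toContinuousLinearEquivOfDetNeZero hdet with hAdef
  have hAcoe : (A : E →L[ℝ] E) = f' p x := (f' p x).coe_toContinuousLinearEquivOfDetNeZero hdet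
  set c : ℝ≥0 := ‖(A.symm : E →L[ℝ] E)‖₊⁻¹ / 2 with hcdef
  set W : Set (E →L[ℝ] E) :=
    {L | Subsingleton E ∨ ‖L - f' p x‖ < c} ∩ {L | |(f' p x).det| / 2 < |L.det|} with hWdef
  have hW₁ : IsOpen {L : E →L[ℝ] E | Subsingleton E ∨ ‖L - f' p x‖ < c} := by
    rw [setOf_or]
    exact isOpen_const.union (isOpen_lt (continuous_norm.comp (continuous_id.sub continuous_const)) continuous_const)
  have hW₂ : IsOpen {L : E →L[ℝ] E | |(f' p x).det| / 2 < |L.det|} :=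
    isOpen_lt continuous_const (continuous_abs.comp ContinuousLinearMap.continuous_det)
  have hWopen : IsOpen W := hW₁.inter hW₂
  have hxW : f' p x ∈ W := by
    refine ⟨?_, half_lt_self (abs_pos.mpr hdet)⟩
    rcases subsingleton_or_nontrivial E with hE | hE
    · exact Or.inl hE
    · right
      rw [sub_self, norm_zero]
      have hpos : 0 < ‖(A.symm : E →L[ℝ] E)‖₊ := A.symm.norm_pos
      have : (0 : ℝ≥0) < c := by
        rw [hcdef]
        exact div_pos (inv_pos.mpr hpos) two_pos
      exact_mod_cast this
  -- the open set `𝒰 ∩ F′⁻¹ W` contains a product neighbourhood `N ×ˢ ball x ε`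
  have hVopen : IsOpen (𝒰 ∩ (fun q : F × E => f' q.1 q.2) ⁻¹' W) := hc.isOpen_inter_preimage h𝒰 hWopen
  have hV : 𝒰 ∩ (fun q : F × E => f' q.1 q.2) ⁻¹' W ∈ 𝓝 (p, x) := hVopen.mem_nhds ⟨hpx, hxW⟩
  obtain ⟨N, hN, V, hVx, hNV⟩ := mem_nhds_prod_iff.mp hV
  obtain ⟨ε, hε, hball⟩ := Metric.mem_nhds_iff.mp hVx
  have hsub : ∀ p' ∈ N, ∀ y ∈ ball x ε, (p', y) ∈ 𝒰 ∧ f' p' y ∈ W := fun p' hp' y hy =>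
    hNV (mk_mem_prod hp' (hball hy))
  refine ⟨N, hN, ball x ε, ball_mem_nhds x hε, isOpen_ball.measurableSet,
    fun q hq => (hNV (mk_mem_prod hq.1 (hball hq.2))).1, fun p' hp' => ⟨?_, fun y hy => ((hsub p' hp' y hy).2.2).le⟩⟩
  rcases subsingleton_or_nontrivial E with hE | hE
  · exact (injective_of_subsingleton (f p')).injOn
  · have happrox : ApproximatesLinearOn (f p') (A : E →L[ℝ] E) (ball x ε) c := by
      intro y hy z hz
      exact Convex.norm_image_sub_le_of_norm_hasFDerivWithin_le'
        (f := f p') (f' := f' p') (φ := (A : E →L[ℝ] E)) (C := (c : ℝ))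
        (fun w hw => (hf (p', w) (hsub p' hp' w hw).1).hasFDerivWithinAt)
        (fun w hw => by
          rw [hAcoe]
          exact (((hsub p' hp' w hw).2.1).resolve_left (not_subsingleton E)).le)
        (convex_ball x ε) hz hy
    refine happrox.injOn (Or.inr ?_)
    have hpos : 0 < ‖(A.symm : E →L[ℝ] E)‖₊ := A.symm.norm_pos
    rw [hcdef]
    exact NNReal.half_lt_self (inv_pos.mpr hpos).ne'

/-- ★★ **QUANTITATIVE LEMMA A, PARAMETRIC.**  `𝒦 ⊆ F × E` compact inside an open `𝒰`; `f : F → E → E` with every `f p`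
measurable, `HasFDerivAt (f p) (f′ p y) y` on `𝒰`, `(p, y) ↦ f′ p y` continuous on `𝒰`, and `det (f′ p x) ≠ 0` on `𝒦`.  Then ONE
finite constant serves every parameter: `∃ C ≠ ∞, ∀ p, ∀ T measurable, μ ({x | (p, x) ∈ 𝒦} ∩ (f p)⁻¹ T) ≤ C·μ T` (finite subcover of
`𝒦` by the product neighbourhoods of `exists_injOn_nhds_param`, §1 on each piece whose parameter neighbourhood contains `p`).
[folklore] -/
theorem exists_measure_inter_preimage_le_param (μ : Measure E) [μ.IsAddHaarMeasure] {𝒰 𝒦 : Set (F × E)} (h𝒰 : IsOpen 𝒰)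
    (h𝒦 : IsCompact 𝒦) (h𝒦𝒰 : 𝒦 ⊆ 𝒰) {f : F → E → E} (hfm : ∀ p, Measurable (f p)) {f' : F → E → E →L[ℝ] E}
    (hf : ∀ q ∈ 𝒰, HasFDerivAt (f q.1) (f' q.1 q.2) q.2) (hc : ContinuousOn (fun q : F × E => f' q.1 q.2) 𝒰)
    (hdet : ∀ q ∈ 𝒦, (f' q.1 q.2).det ≠ 0) :
    ∃ C : ℝ≥0∞, C ≠ ∞ ∧ ∀ (p : F) (T : Set E), MeasurableSet T → μ ({x | (p, x) ∈ 𝒦} ∩ f p ⁻¹' T) ≤ C * μ T := by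
  have hloc : ∀ q ∈ 𝒦, ∃ N : Set F, N ∈ 𝓝 q.1 ∧ ∃ s : Set E, s ∈ 𝓝 q.2 ∧ MeasurableSet s ∧ N ×ˢ s ⊆ 𝒰 ∧
      ∀ p' ∈ N, InjOn (f p') s ∧ ∀ y ∈ s, |(f' q.1 q.2).det| / 2 ≤ |(f' p' y).det| :=
    fun q hq => exists_injOn_nhds_param h𝒰 hf hc (h𝒦𝒰 hq) (hdet q hq)
  choose! N hN s hs hsm hNs hgood using hloc
  obtain ⟨t, ht𝒦, hcover⟩ := h𝒦.elim_nhds_subcover (fun q => N q ×ˢ s q) fun q hq =>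
    prod_mem_nhds (hN q hq) (hs q hq)
  refine ⟨∑ q ∈ t, ENNReal.ofReal (|(f' q.1 q.2).det| / 2)⁻¹, ENNReal.sum_ne_top.mpr fun q _ => ENNReal.ofReal_ne_top,
    fun p T hT => ?_⟩
  -- the piece estimate for each `q ∈ t`
  have hpiece : ∀ q ∈ t, μ ({x | p ∈ N q ∧ x ∈ s q} ∩ f p ⁻¹' T) ≤ ENNReal.ofReal (|(f' q.1 q.2).det| / 2)⁻¹ * μ T := by
    intro q hqt
    have hq𝒦 : q ∈ 𝒦 := ht𝒦 q hqt
    by_cases hp : p ∈ N q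
    · have hset : {x | p ∈ N q ∧ x ∈ s q} = s q := by
        ext x; simp [hp]
      rw [hset]
      have hδ : 0 < |(f' q.1 q.2).det| / 2 := by have := hdet q hq𝒦; positivity
      obtain ⟨hinj, hfloor⟩ := hgood q hq𝒦 p hp
      exact measure_inter_preimage_le_of_injOn_of_det_ge μ (hsm q hq𝒦) (hfm p)
        (fun y hy => (hf (p, y) (hNs q hq𝒦 (mk_mem_prod hp hy))).hasFDerivWithinAt) hinj hδ hfloor hT
    · have hset : {x | p ∈ N q ∧ x ∈ s q} ∩ f p ⁻¹' T = ∅ := by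
        ext x; simp [hp]
      rw [hset, measure_empty]
      exact bot_le
  have hsub : {x | (p, x) ∈ 𝒦} ∩ f p ⁻¹' T ⊆ ⋃ q ∈ t, ({x | p ∈ N q ∧ x ∈ s q} ∩ f p ⁻¹' T) := by
    rintro x ⟨hx𝒦, hxT⟩
    have := hcover hx𝒦
    rw [mem_iUnion₂] at this
    obtain ⟨q, hqt, hq⟩ := this
    exact mem_iUnion₂.mpr ⟨q, hqt, ⟨(mem_prod.mp hq).1, (mem_prod.mp hq).2⟩, hxT⟩
  calc μ ({x | (p, x) ∈ 𝒦} ∩ f p ⁻¹' T)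
      ≤ μ (⋃ q ∈ t, ({x | p ∈ N q ∧ x ∈ s q} ∩ f p ⁻¹' T)) := measure_mono hsub
    _ ≤ ∑ q ∈ t, μ ({x | p ∈ N q ∧ x ∈ s q} ∩ f p ⁻¹' T) := measure_biUnion_finset_le t _
    _ ≤ ∑ q ∈ t, ENNReal.ofReal (|(f' q.1 q.2).det| / 2)⁻¹ * μ T := Finset.sum_le_sum hpiece
    _ = (∑ q ∈ t, ENNReal.ofReal (|(f' q.1 q.2).det| / 2)⁻¹) * μ T := by rw [Finset.sum_mul]

end Param

/-! ## §6 The parametric `C¹` interface (parameters in a normed space) -/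

section ParamC1

variable {F : Type*} [NormedAddCommGroup F] [NormedSpace ℝ F]

/-- ★★ **QUANTITATIVE LEMMA A, PARAMETRIC `C¹` INTERFACE.**  `𝒦 ⊆ F × E` compact inside an open `𝒰`, `φ : F × E → E` with
`ContDiffOn ℝ 1 φ 𝒰`, every section `φ (p, ·)` measurable, and at every `(p, x) ∈ 𝒦` the partial derivative of `φ` in the
`E`-direction is a continuous linear EQUIVALENCE (`∃ D : E ≃L[ℝ] E, HasFDerivAt (φ (p, ·)) D x`).  Then
`∃ C ≠ ∞, ∀ p T, μ ({x | (p, x) ∈ 𝒦} ∩ (φ (p, ·))⁻¹ T) ≤ C·μ T`.  (Partial derivative `= fderiv φ (p, y) ∘ inr`, continuous on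
`𝒰` by `ContDiffOn`; §5.) [folklore] -/
theorem exists_measure_inter_preimage_le_param_of_contDiffOn (μ : Measure E) [μ.IsAddHaarMeasure] {𝒰 𝒦 : Set (F × E)}
    (h𝒰 : IsOpen 𝒰) (h𝒦 : IsCompact 𝒦) (h𝒦𝒰 : 𝒦 ⊆ 𝒰) {φ : F × E → E} (hfm : ∀ p : F, Measurable fun x => φ (p, x))
    (hC1 : ContDiffOn ℝ 1 φ 𝒰)
    (hinv : ∀ q ∈ 𝒦, ∃ D : E ≃L[ℝ] E, HasFDerivAt (fun x => φ (q.1, x)) (D : E →L[ℝ] E) q.2) :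
    ∃ C : ℝ≥0∞, C ≠ ∞ ∧ ∀ (p : F) (T : Set E), MeasurableSet T →
      μ ({x | (p, x) ∈ 𝒦} ∩ (fun x => φ (p, x)) ⁻¹' T) ≤ C * μ T := by
  -- the partial derivative in the `E`-direction
  set f' : F → E → E →L[ℝ] E := fun p y => (fderiv ℝ φ (p, y)).comp (ContinuousLinearMap.inr ℝ F E) with hf'def
  have hdiff : ∀ q ∈ 𝒰, HasFDerivAt (fun x => φ (q.1, x)) (f' q.1 q.2) q.2 := by
    rintro ⟨p, y⟩ hq
    have h1 : HasFDerivAt φ (fderiv ℝ φ (p, y)) (p, y) :=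
      ((hC1.differentiableOn one_ne_zero _ hq).differentiableAt (h𝒰.mem_nhds hq)).hasFDerivAt
    have h2 : HasFDerivAt (fun x : E => (p, x)) (ContinuousLinearMap.inr ℝ F E) y := hasFDerivAt_prodMk_right p y
    exact h1.comp y h2
  have hcont : ContinuousOn (fun q : F × E => f' q.1 q.2) 𝒰 := by
    have h1 : ContinuousOn (fderiv ℝ φ) 𝒰 := hC1.continuousOn_fderiv_of_isOpen h𝒰 le_rfl
    exact ((ContinuousLinearMap.compL ℝ E (F × E) E).flip (ContinuousLinearMap.inr ℝ F E)).continuous.comp_continuousOn h1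
  have hdet : ∀ q ∈ 𝒦, (f' q.1 q.2).det ≠ 0 := by
    intro q hq
    obtain ⟨D, hD⟩ := hinv q hq
    have := (hdiff q (h𝒦𝒰 hq)).unique hD
    rw [this]
    exact det_ne_zero_of_equiv D
  exact exists_measure_inter_preimage_le_param μ h𝒰 h𝒦 h𝒦𝒰 hfm hdiff hcont hdet

end ParamC1

end Summit.QuantumFields.YangMills.Theorems.FluctuationComparisonRegPrIntLQuantLemmaAEuclid

end
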